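import Literature.Probability.LatticeModels.SRWReturnCounts
import Mathlib.Algebra.Ring.GeomSum
import HarnessLib

/-!
# Escape probabilities from the trace of a planar walk: Lawler's identity in finite form

Sixth proof file of the `PlaneNonIntersection` story (named fact
`LSW2001_srw_nonIntersection_five_eighths`, `PlaneNonIntersection.lean`), third input of the
`k^{-1/2}` programme (Lawler 1991, (3.29) via §3.6). The engine of Lawler's Theorem 3.6.1
(`Ē(I⁺ G^λ e^λ) = 1` for translation-invariant measures on two-sided paths) is Proposition
2.4.1(b): for a walk killed at rate `1 - λ`, started at `x ∈ A`,
`1 = P^x{τ̄_A ≤ T} = Σ_{y ∈ A} G_λ(x, y) P^y{τ_A > T}` (last-exit decomposition). Here everything is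
finite and counted over step sequences (`SRW.StepSeq 2 m`, uniform measure = the walk):

* `escSet m y A`, `escProb m y A = #escSet/4^m`: the `m`-step walks from `y` avoiding the finite set
  `A` at times `1, …, m`, and `escProb (m+1) ≤ escProb m` (`escProb_succ_le`, `escProb_mono`);
* **last-exit embedding** (`sum_count_mul_card_escSet_le`): for every start `y₀`, every `A` and
  every length `L`, `Σ_{i ≤ L} Σ_{x ∈ A} c_i(x - y₀) · #escSet (L-i) x A ≤ 4^L` (the classes "last
  visit to `A` at time `i`, at `x`" are disjoint; splitting `StepSeq 2 L ≃ StepSeq 2 i × StepSeq 2 (L-i)`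
  is `splitEquivS`);
* **the weighted form** (`sum_Gtr_mul_etr_le_one`): with the truncated killed Green function
  `Gtr λ L₁ z = Σ_{i ≤ L₁} λ^i p_i(z)` and `etr λ L₁ y A = Σ_{m ≤ L₁} (1-λ) λ^m escProb m y A`,
  `Σ_{x ∈ A} Gtr(x - y₀) · etr(x) ≤ 1` for `0 ≤ λ ≤ 1` — Lawler's `Σ_y G_λ(x,y) P^y{τ > T} = 1` with
  `≤` (truncation);
* **summing over the roots of a path** (`sum_escProb_verts_le`): for `Γ ∈ StepSeq 2 ℓ` with vertex
  set `A = verts Γ`, if `(ℓ+1) g₀ ≤ Σ_{j ≤ ℓ} Gtr(x - Γ(j))` for every `x ∈ A`, then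
  `Σ_{x ∈ A} escProb n x A ≤ 1/((1 - λ^{n+1}) g₀)` (`n ≤ L₁`, `λ < 1`) — the pointwise form of
  (3.19)–(3.24): `Σ_{y ∈ Γ} e(y) ≤ (G̲)⁻¹ (ℓ+1)`;
* **last visits** (`sum_filter_lastVisit_eq_sum_verts`): `Σ_{j : last visit} f(Γ(j)) = Σ_{x ∈ A} f(x)`
  (Lawler's `I⁺`).

## References

* G. F. Lawler, *Intersections of Random Walks*, Birkhäuser 1991, Prop. 2.4.1 (last-exit
  decomposition), Thm. 3.6.1 and (3.18)–(3.19), (3.24) [Lawler1991].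
-/

noncomputable section

open Finset Real Literature.Probability.LatticeModels Literature.Probability.LatticeModels.SRW
open scoped BigOperators

namespace Literature.Probability.RandomPlanarGeometry

namespace PlaneNonIntersection

/-! ### Splitting a step sequence at a time -/

section Split

variable {d m : ℕ}

/-- The first `j` steps. [folklore] -/
def pfxS (ω : StepSeq d m) (j : ℕ) (hj : j ≤ m) : StepSeq d j := fun i => ω (Fin.castLE hj i)

/-- The steps after the first `j`. [folklore] -/
def sfxS (ω : StepSeq d m) (j : ℕ) : StepSeq d (m - j) := fun i => ω ⟨j + i, by omega⟩

/-- Positions up to time `j` are those of the prefix. [folklore] -/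
theorem pos_pfxS (ω : StepSeq d m) {j : ℕ} (hj : j ≤ m) {k : ℕ} (hk : k ≤ j) :
    pos (pfxS ω j hj) k = pos ω k := by
  rw [pos_eq_sum_range _ hk, pos_eq_sum_range _ (hk.trans hj)]
  refine Finset.sum_congr rfl fun i hi => ?_
  have hi' : i < k := Finset.mem_range.1 hi
  rw [dif_pos (by omega : i < j), dif_pos (by omega : i < m)]
  rfl

/-- Positions after time `j` are `ω(j)` plus those of the suffix. [folklore] -/
theorem pos_add_sfxS (ω : StepSeq d m) {j : ℕ} (hj : j ≤ m) {k : ℕ} (hk : k ≤ m - j) :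
    pos ω (j + k) = pos ω j + pos (sfxS ω j) k := by
  rw [pos_eq_sum_range _ (by omega : j + k ≤ m), pos_eq_sum_range _ hj, pos_eq_sum_range _ hk,
    Finset.sum_range_add]
  congr 1
  refine Finset.sum_congr rfl fun i hi => ?_
  have hi' : i < k := Finset.mem_range.1 hi
  rw [dif_pos (by omega : j + i < m), dif_pos (by omega : i < m - j)]
  rfl

/-- A step sequence is determined by its prefix and suffix. [folklore] -/
theorem eq_of_pfxS_eq_of_sfxS_eq (ω ω' : StepSeq d m) {j : ℕ} (hj : j ≤ m)
    (h1 : pfxS ω j hj = pfxS ω' j hj) (h2 : sfxS ω j = sfxS ω' j) : ω = ω' := by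
  funext i
  by_cases hi : (i : ℕ) < j
  · have e : i = Fin.castLE hj ⟨i, hi⟩ := Fin.ext rfl
    rw [e]
    exact congrFun h1 ⟨i, hi⟩
  · have e : i = ⟨j + (i - j), by omega⟩ := Fin.ext (by simp only; omega)
    rw [e]
    exact congrFun h2 ⟨i - j, by omega⟩

/-- **Splitting at time `j`**: `StepSeq d m ≃ StepSeq d j × StepSeq d (m - j)` (`1 ≤ d`).
[folklore] -/
def splitEquivS [NeZero d] {m j : ℕ} (hj : j ≤ m) : StepSeq d m ≃ StepSeq d j × StepSeq d (m - j) :=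
  Equiv.ofBijective (fun ω => (pfxS ω j hj, sfxS ω j))
    ((Fintype.bijective_iff_injective_and_card _).2
      ⟨fun ω ω' h => eq_of_pfxS_eq_of_sfxS_eq ω ω' hj (congrArg Prod.fst h) (congrArg Prod.snd h),
        by rw [Fintype.card_prod, card_stepSeq, card_stepSeq, card_stepSeq, ← pow_add,
          Nat.add_sub_cancel' hj]⟩)

/-- `splitEquivS` is prefix-and-suffix. [folklore] -/
@[simp] theorem splitEquivS_apply [NeZero d] {m j : ℕ} (hj : j ≤ m) (ω : StepSeq d m) :
    splitEquivS hj ω = (pfxS ω j hj, sfxS ω j) := rfl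

end Split

/-! ### Escape counts -/

/-- The `m`-step walks from `y` avoiding the finite set `A` at times `1, …, m`. [folklore] -/
def escSet (m : ℕ) (y : Site 2) (A : Finset (Site 2)) : Finset (StepSeq 2 m) :=
  Finset.univ.filter fun ω => ∀ i < m, y + pos ω (i + 1) ∉ A

/-- Membership in `escSet`. [folklore] -/
theorem mem_escSet {m : ℕ} {y : Site 2} {A : Finset (Site 2)} {ω : StepSeq 2 m} :
    ω ∈ escSet m y A ↔ ∀ i < m, y + pos ω (i + 1) ∉ A := by
  simp [escSet]

/-- The escape probability `q_m(y; A) = #escSet / 4^m` (probability that the walk from `y` avoids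
`A` at times `1, …, m`). [folklore] -/
def escProb (m : ℕ) (y : Site 2) (A : Finset (Site 2)) : ℝ := #(escSet m y A) / 4 ^ m

/-- `0 ≤ q_m`. [folklore] -/
theorem escProb_nonneg (m : ℕ) (y : Site 2) (A : Finset (Site 2)) : 0 ≤ escProb m y A := by
  unfold escProb
  positivity

/-- `q_m ≤ 1`. [folklore] -/
theorem escProb_le_one (m : ℕ) (y : Site 2) (A : Finset (Site 2)) : escProb m y A ≤ 1 := by
  unfold escProb
  rw [div_le_one (by positivity)]
  have h : #(escSet m y A) ≤ 4 ^ m := by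
    calc #(escSet m y A) ≤ #(Finset.univ : Finset (StepSeq 2 m)) := Finset.card_le_univ _
      _ = 4 ^ m := by rw [Finset.card_univ, card_stepSeq]
  exact_mod_cast h

/-- Escaping for `m + 1` steps restricts to escaping for `m` steps: `#escSet (m+1) ≤ 4 #escSet m`.
[folklore] -/
theorem card_escSet_succ_le (m : ℕ) (y : Site 2) (A : Finset (Site 2)) :
    #(escSet (m + 1) y A) ≤ 4 * #(escSet m y A) := by
  have hj : m ≤ m + 1 := Nat.le_succ m
  have hc : 4 = Fintype.card (StepSeq 2 (m + 1 - m)) := by rw [card_stepSeq, Nat.add_sub_cancel_left]; rfl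
  rw [mul_comm, hc, ← Finset.card_univ, ← Finset.card_product]
  refine Finset.card_le_card_of_injOn (splitEquivS hj) ?_ (splitEquivS hj).injective.injOn
  intro ω hω
  rw [Finset.mem_coe, mem_escSet] at hω
  rw [Finset.mem_coe, Finset.mem_product, splitEquivS_apply, mem_escSet]
  refine ⟨fun i hi => ?_, Finset.mem_univ _⟩
  rw [pos_pfxS ω hj (by omega : i + 1 ≤ m)]
  exact hω i (by omega)

/-- `q_{m+1} ≤ q_m`. [folklore] -/
theorem escProb_succ_le (m : ℕ) (y : Site 2) (A : Finset (Site 2)) :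
    escProb (m + 1) y A ≤ escProb m y A := by
  unfold escProb
  rw [div_le_div_iff₀ (by positivity) (by positivity), pow_succ]
  have h : (#(escSet (m + 1) y A) : ℝ) ≤ 4 * #(escSet m y A) := by
    exact_mod_cast card_escSet_succ_le m y A
  nlinarith [pow_pos (show (0 : ℝ) < 4 by norm_num) m]

/-- `q_{m'} ≤ q_m` for `m ≤ m'`. [folklore] -/
theorem escProb_mono {m m' : ℕ} (h : m ≤ m') (y : Site 2) (A : Finset (Site 2)) :
    escProb m' y A ≤ escProb m y A := by
  induction m', h using Nat.le_induction with
  | base => exact le_rfl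
  | succ k _ ih => exact (escProb_succ_le k y A).trans ih

/-- The walks of `i` steps from `y` to `x` are counted by `c_i(x - y)`. [folklore] -/
theorem card_filter_add_endpoint_eq (i : ℕ) (y x : Site 2) :
    #{α : StepSeq 2 i | y + endpoint α = x} = count 2 i (x - y) := by
  rw [count]
  congr 1
  ext α
  simp only [Finset.mem_filter, Finset.mem_univ, true_and]
  constructor
  · intro h; rw [← h]; abel
  · intro h; rw [h]; abel

/-! ### The last-exit embedding -/

/-- **Last-exit embedding** (the finite core of Lawler's Prop. 2.4.1): for every start `y₀`, every
finite `A` and every `L`, `Σ_{i ≤ L} Σ_{x ∈ A} c_i(x - y₀) · #escSet (L - i) x A ≤ 4^L`: an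
`L`-step walk from `y₀` whose last visit to `A` is at time `i`, at the point `x`, splits into an
`i`-step walk `y₀ → x` and an `(L-i)`-step walk from `x` avoiding `A`; distinct `(i, x)` give
disjoint classes. [cite: Lawler1991, Prop. 2.4.1 (proof)] -/
theorem sum_count_mul_card_escSet_le (y₀ : Site 2) (A : Finset (Site 2)) (L : ℕ) :
    ∑ i ∈ Finset.range (L + 1), ∑ x ∈ A, count 2 i (x - y₀) * #(escSet (L - i) x A) ≤ 4 ^ L := by
  classical
  -- the classes inside `StepSeq 2 L`
  let E : ℕ × Site 2 → Finset (StepSeq 2 L) := fun p =>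
    {ω | y₀ + pos ω p.1 = p.2 ∧ ∀ t < L - p.1, y₀ + pos ω (p.1 + (t + 1)) ∉ A}
  have hE : ∀ i ∈ Finset.range (L + 1), ∀ x ∈ A,
      count 2 i (x - y₀) * #(escSet (L - i) x A) = #(E (i, x)) := by
    intro i hi x _
    have hiL : i ≤ L := Nat.le_of_lt_succ (Finset.mem_range.1 hi)
    rw [← card_filter_add_endpoint_eq, ← Finset.card_product]
    symm
    refine Finset.card_equiv (splitEquivS hiL) fun ω => ?_
    simp only [E, Finset.mem_filter, Finset.mem_univ, true_and, Finset.mem_product,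
      splitEquivS_apply, mem_escSet]
    rw [← pos_eq_endpoint, pos_pfxS ω hiL le_rfl]
    refine and_congr_right fun h0 => forall₂_congr fun t ht => ?_
    rw [pos_add_sfxS ω hiL (by omega : t + 1 ≤ L - i), ← add_assoc, h0]
  rw [Finset.sum_congr rfl fun i hi => Finset.sum_congr rfl fun x hx => hE i hi x hx]
  rw [← Finset.sum_product (s := Finset.range (L + 1)) (t := A) (f := fun p => #(E p)),
    ← Finset.card_biUnion]
  · calc #((Finset.range (L + 1) ×ˢ A).biUnion E) ≤ #(Finset.univ : Finset (StepSeq 2 L)) :=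
        Finset.card_le_univ _
      _ = 4 ^ L := by rw [Finset.card_univ, card_stepSeq]
  · rintro ⟨i, x⟩ hp ⟨i', x'⟩ hp' hne
    rw [Finset.mem_coe, Finset.mem_product] at hp hp'
    have hiL : i ≤ L := Nat.le_of_lt_succ (Finset.mem_range.1 hp.1)
    have hiL' : i' ≤ L := Nat.le_of_lt_succ (Finset.mem_range.1 hp'.1)
    dsimp only [Function.onFun]
    rw [Finset.disjoint_filter]
    rintro ω - ⟨h0, h1⟩ ⟨h0', h1'⟩
    rcases lt_trichotomy i i' with hlt | heq | hlt
    · have h := h1 (i' - i - 1) (by omega)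
      rw [show i + (i' - i - 1 + 1) = i' by omega, h0'] at h
      exact h hp'.2
    · subst heq
      exact hne (Prod.ext rfl (h0.symm.trans h0'))
    · have h := h1' (i - i' - 1) (by omega)
      rw [show i' + (i - i' - 1 + 1) = i by omega, h0] at h
      exact h hp.2

/-! ### The weighted form: truncated killed Green function and escape transform -/

/-- The truncated killed Green function `G(z) = Σ_{i ≤ L₁} λ^i p_i(z)`. [folklore] -/
def Gtr (lam : ℝ) (L₁ : ℕ) (z : Site 2) : ℝ := ∑ i ∈ Finset.range (L₁ + 1), lam ^ i * prob 2 i z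

/-- The truncated escape transform `e(y) = Σ_{m ≤ L₁} (1-λ) λ^m q_m(y; A)` (the probability that
the walk from `y`, killed at rate `1 - λ` before time `L₁`, avoids `A` until killed).
[folklore] -/
def etr (lam : ℝ) (L₁ : ℕ) (y : Site 2) (A : Finset (Site 2)) : ℝ :=
  ∑ m ∈ Finset.range (L₁ + 1), (1 - lam) * lam ^ m * escProb m y A

/-- `G ≥ 0`. [folklore] -/
theorem Gtr_nonneg {lam : ℝ} (hl : 0 ≤ lam) (L₁ : ℕ) (z : Site 2) : 0 ≤ Gtr lam L₁ z :=
  Finset.sum_nonneg fun i _ => mul_nonneg (pow_nonneg hl i) (prob_nonneg i z)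

/-- `e ≥ 0`. [folklore] -/
theorem etr_nonneg {lam : ℝ} (hl0 : 0 ≤ lam) (hl1 : lam ≤ 1) (L₁ : ℕ) (y : Site 2)
    (A : Finset (Site 2)) : 0 ≤ etr lam L₁ y A :=
  Finset.sum_nonneg fun m _ => mul_nonneg (mul_nonneg (by linarith) (pow_nonneg hl0 m))
    (escProb_nonneg m y A)

/-- **Lawler's identity, truncated**: `Σ_{x ∈ A} G(x - y₀) e(x) ≤ 1` for `0 ≤ λ ≤ 1`
(regroup the double sum over `(i, m)` by `L = i + m ≤ 2L₁`, apply the last-exit embedding at each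
`L`, and sum the geometric weights `(1-λ) λ^L`). [cite: Lawler1991, Prop. 2.4.1(b)] -/
theorem sum_Gtr_mul_etr_le_one {lam : ℝ} (hl0 : 0 ≤ lam) (hl1 : lam ≤ 1) (L₁ : ℕ) (y₀ : Site 2)
    (A : Finset (Site 2)) :
    ∑ x ∈ A, Gtr lam L₁ (x - y₀) * etr lam L₁ x A ≤ 1 := by
  classical
  -- the nonnegative summand indexed by `(L, i)`
  set f : (Σ _ : ℕ, ℕ) → ℝ := fun p => (1 - lam) * lam ^ p.1 / 4 ^ p.1 *
    ∑ x ∈ A, (count 2 p.2 (x - y₀) : ℝ) * #(escSet (p.1 - p.2) x A) with hf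
  have hf0 : ∀ p, 0 ≤ f p := fun p => by
    rw [hf]
    exact mul_nonneg (div_nonneg (mul_nonneg (by linarith) (pow_nonneg hl0 _)) (by positivity))
      (Finset.sum_nonneg fun x _ => by positivity)
  set P : Finset (ℕ × ℕ) := Finset.range (L₁ + 1) ×ˢ Finset.range (L₁ + 1) with hP
  set Q : Finset (Σ _ : ℕ, ℕ) := (Finset.range (2 * L₁ + 1)).sigma fun L => Finset.range (L + 1)
    with hQ
  set φ : ℕ × ℕ → (Σ _ : ℕ, ℕ) := fun p => ⟨p.1 + p.2, p.1⟩ with hφ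
  have hφinj : Set.InjOn φ P := by
    rintro ⟨a, b⟩ - ⟨a', b'⟩ - h
    simp only [hφ, Sigma.mk.injEq, heq_eq_eq] at h
    obtain ⟨h1, h2⟩ := h
    subst h2
    simp only [Prod.mk.injEq, true_and]
    omega
  have hφP : P.image φ ⊆ Q := by
    intro p hp
    rw [Finset.mem_image] at hp
    obtain ⟨⟨a, b⟩, hab, rfl⟩ := hp
    rw [hP, Finset.mem_product, Finset.mem_range, Finset.mem_range] at hab
    simp only [hQ, hφ, Finset.mem_sigma, Finset.mem_range]
    omega
  -- Step 1: the double sum is `Σ_{p ∈ P} f (φ p)`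
  have h1 : ∑ x ∈ A, Gtr lam L₁ (x - y₀) * etr lam L₁ x A = ∑ p ∈ P, f (φ p) := by
    have hexp : ∀ x ∈ A, Gtr lam L₁ (x - y₀) * etr lam L₁ x A =
        ∑ p ∈ P, (1 - lam) * lam ^ (p.1 + p.2) / 4 ^ (p.1 + p.2) *
          ((count 2 p.1 (x - y₀) : ℝ) * #(escSet p.2 x A)) := by
      intro x _
      rw [Gtr, etr, Finset.sum_mul_sum, hP, Finset.sum_product]
      refine Finset.sum_congr rfl fun i _ => Finset.sum_congr rfl fun m _ => ?_
      rw [prob, escProb]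
      dsimp only
      have h4 : ((2 : ℝ) * ((2 : ℕ) : ℝ)) = 4 := by norm_num
      rw [h4, pow_add]
      field_simp
      ring
    rw [Finset.sum_congr rfl hexp, Finset.sum_comm]
    refine Finset.sum_congr rfl fun p _ => ?_
    rw [hf, hφ]
    dsimp only
    rw [Nat.add_sub_cancel_left, Finset.mul_sum]
  -- Step 2: regroup by `L = i + m`
  have h2 : ∑ p ∈ P, f (φ p) ≤ ∑ q ∈ Q, f q := by
    rw [← Finset.sum_image hφinj]
    exact Finset.sum_le_sum_of_subset_of_nonneg hφP fun q _ _ => hf0 q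
  -- Step 3: for each `L`, the last-exit embedding
  have h3 : ∑ q ∈ Q, f q ≤ ∑ L ∈ Finset.range (2 * L₁ + 1), (1 - lam) * lam ^ L := by
    rw [hQ, Finset.sum_sigma]
    refine Finset.sum_le_sum fun L _ => ?_
    have hemb : (∑ i ∈ Finset.range (L + 1),
        ∑ x ∈ A, (count 2 i (x - y₀) : ℝ) * #(escSet (L - i) x A)) ≤ 4 ^ L := by
      have h := sum_count_mul_card_escSet_le y₀ A L
      exact_mod_cast h
    calc ∑ i ∈ Finset.range (L + 1), f ⟨L, i⟩
        = (1 - lam) * lam ^ L / 4 ^ L * ∑ i ∈ Finset.range (L + 1),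
            ∑ x ∈ A, (count 2 i (x - y₀) : ℝ) * #(escSet (L - i) x A) := by
          rw [Finset.mul_sum]
      _ ≤ (1 - lam) * lam ^ L / 4 ^ L * 4 ^ L :=
          mul_le_mul_of_nonneg_left hemb
            (div_nonneg (mul_nonneg (by linarith) (pow_nonneg hl0 _)) (by positivity))
      _ = (1 - lam) * lam ^ L := by field_simp
  -- Step 4: the geometric weights sum to `1 - λ^{2L₁+1} ≤ 1`
  have h4 : ∑ L ∈ Finset.range (2 * L₁ + 1), (1 - lam) * lam ^ L ≤ 1 := by
    rw [← Finset.mul_sum, mul_comm, geom_sum_mul_neg]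
    linarith [pow_nonneg hl0 (2 * L₁ + 1)]
  linarith [h1, h2, h3, h4]

/-! ### Summing over the roots of a path -/

/-- The vertex set `{Γ(0), …, Γ(ℓ)}` of a step sequence, as a finite set. [folklore] -/
def verts {ℓ : ℕ} (Γ : StepSeq 2 ℓ) : Finset (Site 2) := (Finset.range (ℓ + 1)).image (pos Γ)

/-- `Γ(j) ∈ verts Γ` for `j ≤ ℓ`. [folklore] -/
theorem pos_mem_verts {ℓ : ℕ} (Γ : StepSeq 2 ℓ) {j : ℕ} (hj : j ≤ ℓ) : pos Γ j ∈ verts Γ :=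
  Finset.mem_image.2 ⟨j, Finset.mem_range.2 (Nat.lt_succ_of_le hj), rfl⟩

/-- Membership in `verts`. [folklore] -/
theorem mem_verts {ℓ : ℕ} {Γ : StepSeq 2 ℓ} {x : Site 2} : x ∈ verts Γ ↔ ∃ j ≤ ℓ, pos Γ j = x := by
  simp only [verts, Finset.mem_image, Finset.mem_range]
  constructor
  · rintro ⟨j, hj, rfl⟩; exact ⟨j, Nat.le_of_lt_succ hj, rfl⟩
  · rintro ⟨j, hj, rfl⟩; exact ⟨j, Nat.lt_succ_of_le hj, rfl⟩

/-- **Summing Lawler's identity over the roots of a path** (the pointwise form of (3.24)): if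
`(ℓ+1) g₀ ≤ Σ_{j ≤ ℓ} G(x - Γ(j))` for every vertex `x` of `Γ`, then `Σ_{x ∈ verts Γ} e(x) ≤ 1/g₀`.
[cite: Lawler1991, (3.19)–(3.24)] -/
theorem sum_etr_verts_le {lam : ℝ} (hl0 : 0 ≤ lam) (hl1 : lam ≤ 1) (L₁ : ℕ) {ℓ : ℕ}
    (Γ : StepSeq 2 ℓ) {g₀ : ℝ} (hg₀ : 0 < g₀)
    (hG : ∀ x ∈ verts Γ, (ℓ + 1 : ℝ) * g₀ ≤ ∑ j ∈ Finset.range (ℓ + 1), Gtr lam L₁ (x - pos Γ j)) :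
    ∑ x ∈ verts Γ, etr lam L₁ x (verts Γ) ≤ 1 / g₀ := by
  have h1 : ∑ j ∈ Finset.range (ℓ + 1), ∑ x ∈ verts Γ,
      Gtr lam L₁ (x - pos Γ j) * etr lam L₁ x (verts Γ) ≤ (ℓ + 1 : ℝ) := by
    calc ∑ j ∈ Finset.range (ℓ + 1), ∑ x ∈ verts Γ, Gtr lam L₁ (x - pos Γ j) * etr lam L₁ x (verts Γ)
        ≤ ∑ _j ∈ Finset.range (ℓ + 1), (1 : ℝ) :=
          Finset.sum_le_sum fun j _ => sum_Gtr_mul_etr_le_one hl0 hl1 L₁ (pos Γ j) (verts Γ)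
      _ = ℓ + 1 := by simp
  rw [Finset.sum_comm] at h1
  have h2 : (ℓ + 1 : ℝ) * g₀ * ∑ x ∈ verts Γ, etr lam L₁ x (verts Γ) ≤
      ∑ x ∈ verts Γ, ∑ j ∈ Finset.range (ℓ + 1), Gtr lam L₁ (x - pos Γ j) * etr lam L₁ x (verts Γ) := by
    rw [Finset.mul_sum]
    refine Finset.sum_le_sum fun x hx => ?_
    rw [← Finset.sum_mul]
    exact mul_le_mul_of_nonneg_right (hG x hx) (etr_nonneg hl0 hl1 L₁ x _)
  have hℓ : (0 : ℝ) < ℓ + 1 := by positivity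
  rw [le_div_iff₀ hg₀]
  nlinarith [h1, h2, Finset.sum_nonneg fun x (_ : x ∈ verts Γ) => etr_nonneg hl0 hl1 L₁ x (verts Γ)]

/-- `e(y) ≥ (1 - λ^{n+1}) q_n(y)` for `n ≤ L₁` (`q_m` is non-increasing in `m`). [folklore] -/
theorem one_sub_pow_mul_escProb_le_etr {lam : ℝ} (hl0 : 0 ≤ lam) (hl1 : lam ≤ 1) {L₁ n : ℕ}
    (hn : n ≤ L₁) (y : Site 2) (A : Finset (Site 2)) :
    (1 - lam ^ (n + 1)) * escProb n y A ≤ etr lam L₁ y A := by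
  have h1 : (1 - lam ^ (n + 1)) * escProb n y A =
      ∑ m ∈ Finset.range (n + 1), (1 - lam) * lam ^ m * escProb n y A := by
    rw [← Finset.sum_mul, ← Finset.mul_sum, mul_comm (1 - lam), geom_sum_mul_neg]
  rw [h1, etr]
  calc ∑ m ∈ Finset.range (n + 1), (1 - lam) * lam ^ m * escProb n y A
      ≤ ∑ m ∈ Finset.range (n + 1), (1 - lam) * lam ^ m * escProb m y A :=
        Finset.sum_le_sum fun m hm => mul_le_mul_of_nonneg_left
          (escProb_mono (Nat.le_of_lt_succ (Finset.mem_range.1 hm)) y A)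
          (mul_nonneg (by linarith) (pow_nonneg hl0 m))
    _ ≤ ∑ m ∈ Finset.range (L₁ + 1), (1 - lam) * lam ^ m * escProb m y A :=
        Finset.sum_le_sum_of_subset_of_nonneg
          (Finset.range_subset_range.2 (by omega)) fun m _ _ =>
            mul_nonneg (mul_nonneg (by linarith) (pow_nonneg hl0 m)) (escProb_nonneg m y A)

/-- **The escape sum of a path**: under the hypothesis of `sum_etr_verts_le` and for `n ≤ L₁`,
`λ < 1`, `Σ_{x ∈ verts Γ} q_n(x; verts Γ) ≤ 1/((1 - λ^{n+1}) g₀)`. [cite: Lawler1991, (3.24)] -/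
theorem sum_escProb_verts_le {lam : ℝ} (hl0 : 0 ≤ lam) (hl1 : lam < 1) {L₁ n : ℕ} (hn : n ≤ L₁)
    {ℓ : ℕ} (Γ : StepSeq 2 ℓ) {g₀ : ℝ} (hg₀ : 0 < g₀)
    (hG : ∀ x ∈ verts Γ, (ℓ + 1 : ℝ) * g₀ ≤ ∑ j ∈ Finset.range (ℓ + 1), Gtr lam L₁ (x - pos Γ j)) :
    ∑ x ∈ verts Γ, escProb n x (verts Γ) ≤ 1 / ((1 - lam ^ (n + 1)) * g₀) := by
  have hpow : lam ^ (n + 1) < 1 := pow_lt_one₀ hl0 hl1 (Nat.succ_ne_zero n)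
  have hc : 0 < 1 - lam ^ (n + 1) := by linarith
  have h1 := sum_etr_verts_le hl0 hl1.le L₁ Γ hg₀ hG
  have h2 : (1 - lam ^ (n + 1)) * ∑ x ∈ verts Γ, escProb n x (verts Γ) ≤
      ∑ x ∈ verts Γ, etr lam L₁ x (verts Γ) := by
    rw [Finset.mul_sum]
    exact Finset.sum_le_sum fun x _ => one_sub_pow_mul_escProb_le_etr hl0 hl1.le hn x _
  rw [le_div_iff₀ (mul_pos hc hg₀)]
  calc (∑ x ∈ verts Γ, escProb n x (verts Γ)) * ((1 - lam ^ (n + 1)) * g₀)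
      = ((1 - lam ^ (n + 1)) * ∑ x ∈ verts Γ, escProb n x (verts Γ)) * g₀ := by ring
    _ ≤ (∑ x ∈ verts Γ, etr lam L₁ x (verts Γ)) * g₀ := mul_le_mul_of_nonneg_right h2 hg₀.le
    _ ≤ 1 / g₀ * g₀ := mul_le_mul_of_nonneg_right h1 hg₀.le
    _ = 1 := by field_simp

/-! ### Last visits (Lawler's `I⁺`) -/

/-- **Last visits index the vertex set**: summing `f(Γ(j))` over the indices `j ≤ ℓ` that are the
last visit of `Γ` to `Γ(j)` is summing `f` over the vertex set. [folklore] -/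
theorem sum_filter_lastVisit_eq_sum_verts {ℓ : ℕ} (Γ : StepSeq 2 ℓ) (f : Site 2 → ℝ) :
    ∑ j ∈ (Finset.range (ℓ + 1)).filter (fun j => ∀ j' ≤ ℓ, j < j' → pos Γ j' ≠ pos Γ j),
      f (pos Γ j) = ∑ x ∈ verts Γ, f x := by
  classical
  set J : Finset ℕ := (Finset.range (ℓ + 1)).filter (fun j => ∀ j' ≤ ℓ, j < j' → pos Γ j' ≠ pos Γ j)
    with hJ
  have hinj : Set.InjOn (pos Γ) J := by
    intro j hj j' hj' h
    rw [Finset.mem_coe, hJ, Finset.mem_filter, Finset.mem_range] at hj hj'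
    by_contra hne
    rcases lt_or_gt_of_ne hne with hlt | hlt
    · exact hj.2 j' (Nat.le_of_lt_succ hj'.1) hlt h.symm
    · exact hj'.2 j (Nat.le_of_lt_succ hj.1) hlt h
  have himage : J.image (pos Γ) = verts Γ := by
    ext x
    rw [Finset.mem_image, mem_verts]
    constructor
    · rintro ⟨j, hj, rfl⟩
      rw [hJ, Finset.mem_filter, Finset.mem_range] at hj
      exact ⟨j, Nat.le_of_lt_succ hj.1, rfl⟩
    · rintro ⟨j, hj, rfl⟩
      -- the last index with the same position
      have hex : ∃ k, k ≤ ℓ ∧ pos Γ k = pos Γ j := ⟨j, hj, rfl⟩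
      let k := Nat.findGreatest (fun k => pos Γ k = pos Γ j) ℓ
      have hk : pos Γ k = pos Γ j := Nat.findGreatest_spec (P := fun k => pos Γ k = pos Γ j) hj rfl
      have hkℓ : k ≤ ℓ := Nat.findGreatest_le ℓ
      refine ⟨k, ?_, hk⟩
      rw [hJ, Finset.mem_filter, Finset.mem_range]
      refine ⟨Nat.lt_succ_of_le hkℓ, fun j' hj' hlt h => ?_⟩
      have := Nat.le_findGreatest (P := fun k => pos Γ k = pos Γ j) hj' (h.trans hk)
      exact absurd this (not_le.2 hlt)
  rw [← himage, Finset.sum_image hinj]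

end PlaneNonIntersection

end Literature.Probability.RandomPlanarGeometry

end
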